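import Summits.BirchSwinnertonDyer.Rank1Residual.X5.TransverseRelaxedStrictCount
import Summits.BirchSwinnertonDyer.Rank1Residual.GaloisImage.KolyvaginPrimeLocalShapeRatHolds
import Literature.NumberTheory.GaloisCohomology.PoitouTateSelmerStructuresRealPlaces
import HarnessLib

/-!
# The level count in Rubin's / Kolyvagin-datum spelling and at the Frobenius-class (Kolyvagin)
# primes of `τ`: `[H¹_{𝓚(T)^{v₀}} : H¹_{𝓚(T)_{v₀}}] = #E(K_{v₀})[p] · #(𝓞_{v₀}/p)`
# (cell `b2b-bsdres`; O1 PROVER ORDER v2.8 item (ii) G3-T4, follow-up (ii-b); file 2 of 3, sequel of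
# `X5/TransverseRelaxedStrictCount.lean`, followed by `X5/TransverseRelaxedStrictCountRat.lean`
# (`K = ℚ`, `p = 2`: `a(T) − b(T) = 1 + e`); seat x11b3-p9 GEN 3, cross-cell pool work)

HONEST FRAMING (cell `b2b-bsdres`, run/shared/lean/b2b/bsd-rank1-residual/, verbatim in every file): the
goal of the cell is to DELETE the COMBINATION-SHAPED residual classes of the Birch–Swinnerton-Dyer
formula for ALL analytic-rank `≤ 1` elliptic curves over `ℚ` — "full BSD formula for every rank `≤ 1`
curve in class `C`" assembled STRICTLY from published theorems — so that the rank-`≤ 1` remainder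
becomes exactly the CONSTRUCTION-SHAPED classes, which are TYPED (missing-input `Prop`s), NOT
attempted. This is not "finishing BSD". Team O1 (X5 at `p = 2`): research routes; O1 OPEN; nothing
booked; no mark / label / count moved. THEOREMS ONLY: no definition, no named fact is minted, no
`sorry`. CONDITIONAL exactly as file 1 (`inv` with the Poitou–Tate properties and injective at the real
places, Tate's local Euler characteristic `hEP`, the Kolyvagin-prime hypotheses at `𝔮 ∈ T` BY NAME);
at the FROBENIUS-CLASS primes of `τ` (`frobeniusClassPrimes E[p] S τ p` of
`Literature/…/GaloisCohomology/KolyvaginSystems`, with `E[p]/(τ − 1) ≃ ℤ/p` and `τ` fixing `μ_p`)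
three of them are DISCHARGED by the tree (`p ∉ 𝔮`, `E[p]` unramified at `𝔮`, `(N𝔮 − 1)·E[p] = 0` —
`GaloisImage.absNorm_sub_one_smul_eq_zero_of_mem_frobeniusClassPrimes`, and the cyclicity flag
`#E[p]^{Γ_{K_𝔮}} = p` — `GaloisImage.natCard_invariants_toLocal_of_mem_frobeniusClassPrimes`), leaving
`N𝔮` prime and the total ramification of `K_𝔮(μ_{N𝔮})/K_𝔮` (`hχI`), both automatic over `ℚ` (file 3).

## What this file proves

* `strictAt_singleton_eq_update`, `relaxedAt_singleton_eq_update` — Rubin's `𝓖_{v₀}` / `𝓖^{v₀}`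
  (`strictAt {v₀}` / `relaxedAt {v₀}`) are `Function.update 𝓖 v₀ ⊥ / ⊤`;
  `natCard_selmerGroup_update_top_eq` — cardinality form `#H¹_{𝓛^{v₀}} = [H¹_{𝓛^{v₀}} : H¹_{𝓛_{v₀}}] · #H¹_{𝓛_{v₀}}`;
* `relIndex_transverseAt_strictAt_relaxedAt_eq`, **`relIndex_atLevel_strictAt_relaxedAt_eq`** — the level
  count of file 1 in Rubin's spelling and for a `KolyvaginDatum` with the cyclotomic transverse
  conditions (`D.atLevel 𝓚 T = 𝓚(T)`, Rubin's `𝓕(n)` for `𝓕 = 𝓚`);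
* `natCard_fixed_toLocal_eq_of_mem_frobeniusClassPrimes` — `#E[p]^{Γ_{K_𝔮}} = N` at a Frobenius-class
  prime of `τ` with `E[p]/(τ − 1) ≃ ℤ/N` (the tree's invariant count, re-read on the subtype of fixed
  torsion points used by file 1);
* **`relIndex_transverseAt_update_bot_update_top_eq_of_mem_frobeniusClassPrimes`** — the level count
  for `T ⊆ frobeniusClassPrimes E[p] S τ p` (`E[p]/(τ − 1) ≃ ℤ/p`, `τ ∈ Gal(K̄/K(μ_p))`): the only
  per-prime hypotheses left are `N𝔮` prime and `hχI`;
* **`relIndex_transverseAt_update_bot_update_top_eq_of_facts`** — the same with the family `inv` and its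
  five properties REPLACED by the tree's cited NAMED FACT `poitouTate_selmerStructure_duality_real K`
  (b2b-bsdres-lit GEN 53, p283639: Milne ADT I Ex. 1.6 (c) + Thm. 4.10; ASK L-G18.1 CLOSED) — the count is
  `inv`-free, so the END statements are CONDITIONAL on exactly two named facts (that one and
  `localEulerPoincareCharacteristic`), taken as hypotheses.

References: [MazurRubin2004] Def. 2.1.1, §3.5, §4.3; [Rubin2011] Def. 1.9.4, Prop. 1.9.5, Def. 2.1.1,
Def. 2.1.3, Prop. 2.6.1; [Sakamoto2024] §2 (the set `𝒫`), Def. 3.3; [MilneADT2006] I Thm. 2.8,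
Thm. 4.10, Lemma 6.15.
-/

noncomputable section

open scoped Classical

open CategoryTheory Field Function NumberField IsDedekindDomain WeierstrassCurve
open Literature.NumberTheory.EllipticCurves
open Literature.NumberTheory.GaloisRepresentations
open Literature.NumberTheory.GaloisRepresentations.DiscreteGaloisModule (mu MuCarrier SelmerStructure
  localTatePairingZMod tateDual localMap transverseSubgroup)
open Literature.NumberTheory.GaloisCohomology
open Summit.BirchSwinnertonDyer.Rank1Residual.X11b.LocBridge
open Summit.BirchSwinnertonDyer.Rank1Residual.X11b.Levels
open scoped ContRepresentation

namespace Summit.BirchSwinnertonDyer.Rank1Residual.X5.TransverseCount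

/-! ## §N3b. The level count in Rubin's spelling and for a Kolyvagin datum -/

section Level

variable {K : Type} [Field K] [NumberField K] (W : WeierstrassCurve K) [W.IsElliptic]

omit [W.IsElliptic] in
/-- `𝓖_{v₀}` in Rubin's spelling (`strictAt {v₀}`) is `Function.update 𝓖 v₀ ⊥`.
[cite: Rubin2011, Def. 2.1.1 (p. 17)] -/
theorem strictAt_singleton_eq_update {n : ℤ} (𝓖 : SelmerStructure (W.torsionGaloisModule n))
    (q : HeightOneSpectrum (𝓞 K)) : 𝓖.strictAt {q} = Function.update 𝓖 (Sum.inr q) ⊥ := by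
  funext v
  by_cases hv : v = Sum.inr q
  · subst hv
    rw [Function.update_self]
    exact SelmerStructure.modify_inr_of_mem_strict 𝓖 𝓖 (Finset.notMem_empty q) (Finset.mem_singleton_self q)
  · rw [Function.update_of_ne hv]
    rcases v with w | v
    · rfl
    · exact SelmerStructure.modify_inr_of_not_mem 𝓖 𝓖 (Finset.notMem_empty v)
        (fun h => hv (by rw [Finset.mem_singleton.mp h])) (Finset.notMem_empty v)

omit [W.IsElliptic] in
/-- `𝓖^{v₀}` in Rubin's spelling (`relaxedAt {v₀}`) is `Function.update 𝓖 v₀ ⊤`.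
[cite: Rubin2011, Def. 2.1.1 (p. 17)] -/
theorem relaxedAt_singleton_eq_update {n : ℤ} (𝓖 : SelmerStructure (W.torsionGaloisModule n))
    (q : HeightOneSpectrum (𝓞 K)) : 𝓖.relaxedAt {q} = Function.update 𝓖 (Sum.inr q) ⊤ := by
  funext v
  by_cases hv : v = Sum.inr q
  · subst hv
    rw [Function.update_self]
    exact SelmerStructure.modify_inr_of_mem_relaxed 𝓖 𝓖 (Finset.mem_singleton_self q)
  · rw [Function.update_of_ne hv]
    rcases v with w | v
    · rfl
    · exact SelmerStructure.modify_inr_of_not_mem 𝓖 𝓖 (fun h => hv (by rw [Finset.mem_singleton.mp h]))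
        (Finset.notMem_empty v) (Finset.notMem_empty v)

omit [W.IsElliptic] in
/-- `#K = [K : H] · #H` for additive subgroups `H ≤ K` (index conventions of `AddSubgroup.relIndex`;
no finiteness needed). [folklore] -/
theorem natCard_eq_relIndex_mul_natCard {G : Type*} [AddGroup G] {H L : AddSubgroup G} (h : H ≤ L) :
    Nat.card L = H.relIndex L * Nat.card H := by
  unfold AddSubgroup.relIndex
  rw [← Nat.card_congr (AddSubgroup.addSubgroupOfEquivOfLe h).toEquiv, mul_comm]
  exact (AddSubgroup.card_mul_index (H.addSubgroupOf L)).symm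

omit [W.IsElliptic] in
/-- **Cardinality form of a relaxed/strict index**: `#H¹_{𝓛^{v₀}} = [H¹_{𝓛^{v₀}} : H¹_{𝓛_{v₀}}] · #H¹_{𝓛_{v₀}}`
(`H¹_{𝓛_{v₀}} ≤ H¹_{𝓛^{v₀}}` by monotonicity of the Selmer group in the structure).
[cite: Howard2004HeegnerKolyvagin, Def. 2.1.6 (arXiv:1202.6340 p. 5)] -/
theorem natCard_selmerGroup_update_top_eq {n : ℤ} (𝓛 : SelmerStructure (W.torsionGaloisModule n))
    (v₀ : Place K) :
    Nat.card (SelmerStructure.selmerGroup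
        (Function.update 𝓛 v₀ ⊤ : SelmerStructure (W.torsionGaloisModule n))) =
      (SelmerStructure.selmerGroup
            (Function.update 𝓛 v₀ ⊥ : SelmerStructure (W.torsionGaloisModule n))).relIndex
          (SelmerStructure.selmerGroup
            (Function.update 𝓛 v₀ ⊤ : SelmerStructure (W.torsionGaloisModule n))) *
        Nat.card (SelmerStructure.selmerGroup
          (Function.update 𝓛 v₀ ⊥ : SelmerStructure (W.torsionGaloisModule n))) := by
  refine natCard_eq_relIndex_mul_natCard fun x hx => ?_
  rw [SelmerStructure.mem_selmerGroup_iff] at hx ⊢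
  intro v
  by_cases hv : v = v₀
  · subst hv
    rw [Function.update_self]
    exact AddSubgroup.mem_top _
  · rw [Function.update_of_ne hv]
    have h := hx v
    rwa [Function.update_of_ne hv] at h

variable (p : ℕ) [hp : Fact p.Prime]

/-- **The level count in Rubin's spelling** `𝓚(T)_{v₀} = strictAt {v₀}`, `𝓚(T)^{v₀} = relaxedAt {v₀}`
(`Literature/…/GaloisCohomology/KolyvaginSystems`, Sakamoto Def. 3.3):
`[H¹_{𝓚(T)^{v₀}} : H¹_{𝓚(T)_{v₀}}] = #E(K_{v₀})[p] · #(𝓞_{v₀}/p)` (hypotheses as in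
`relIndex_transverseAt_update_bot_update_top_eq`). [cite: Rubin2011, Def. 2.1.1 and Prop. 2.6.1 (pp. 17–22)]
[cite: Sakamoto2024, Def. 3.3 (p. 922)] -/
theorem relIndex_transverseAt_strictAt_relaxedAt_eq (inv : LocalInvariants K p)
    (hperf : inv.IsPerfect) (hvan : inv.SumLocalTermEqZero) (hcomp : inv.SelmerComplement)
    (hEP : ∀ v : HeightOneSpectrum (𝓞 K), localEulerPoincareCharacteristic (v.adicCompletion K))
    (hreal : ∀ w : InfinitePlace K, w.IsReal → Injective (inv (Sum.inl w)))
    (T : Finset (HeightOneSpectrum (𝓞 K)))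
    (hpT : ∀ q ∈ T, ((p : ℕ) : 𝓞 K) ∉ q.asIdeal)
    (hur : ∀ q ∈ T, GaloisRep.IsUnramifiedAt q (W.torsionGaloisModule (p : ℤ)))
    (hprime : ∀ q ∈ T, (Ideal.absNorm q.asIdeal).Prime)
    (hM : ∀ q ∈ T, ∀ m : geomTorsion W p, (Ideal.absNorm q.asIdeal - 1) • m = 0)
    (hχI : ∀ q ∈ T, ∀ [Fact (Ideal.absNorm q.asIdeal).Prime]
      [NeZero ((Ideal.absNorm q.asIdeal : ℕ) : q.adicCompletion K)],
      ∀ u : (ZMod (Ideal.absNorm q.asIdeal))ˣ, ∃ t ∈ absInertia (q.adicCompletion K),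
        modPCyclotomicCharacterZMod (q.adicCompletion K) (Ideal.absNorm q.asIdeal) t = u)
    (hcyc : ∀ q ∈ T, ∃ R : geomTorsion W p, ∀ S : geomTorsion W p,
      (∀ g : absoluteGaloisGroup (q.adicCompletion K), GaloisRep.toLocal q (W.torsionGaloisModule p) g S = S) →
        ∃ a : ℕ, S = a • R)
    (w₀ : HeightOneSpectrum (𝓞 K)) :
    (((W.kummerSelmerStructure (p : ℤ)).transverseAt
          (cyclotomicTransverse (W.torsionGaloisModule (p : ℤ))) T).strictAt {w₀}).selmerGroup.relIndex
        (((W.kummerSelmerStructure (p : ℤ)).transverseAt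
          (cyclotomicTransverse (W.torsionGaloisModule (p : ℤ))) T).relaxedAt {w₀}).selmerGroup =
      Nat.card (nsmulAddMonoidHom p : (W.baseChange (w₀.adicCompletion K)).toAffine.Point →+ _).ker *
        Nat.card (w₀.adicCompletionIntegers K ⧸ Ideal.span {(p : w₀.adicCompletionIntegers K)}) := by
  rw [strictAt_singleton_eq_update, relaxedAt_singleton_eq_update]
  exact relIndex_transverseAt_update_bot_update_top_eq W p inv hperf hvan hcomp hEP hreal T hpT hur hprime
    hM hχI hcyc w₀

/-- **The level count for a Kolyvagin datum with the cyclotomic transverse conditions**: for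
`D : KolyvaginDatum E[p]` with `D.transverse = cyclotomicTransverse E[p]` and a finite set `T` of primes
satisfying the Kolyvagin-prime hypotheses (e.g. a level `T ⊆ D.primes` of Mazur–Rubin primes),
`[H¹_{𝓚(T)^{v₀}} : H¹_{𝓚(T)_{v₀}}] = #E(K_{v₀})[p] · #(𝓞_{v₀}/p)` for `𝓚(T) = D.atLevel 𝓚 T`
(Rubin's `𝓕(n)` with `𝓕 = 𝓚`; Sakamoto Def. 3.3). [cite: Rubin2011, Def. 2.1.1 and Def. 2.2.3 (pp. 17–18)]
[cite: MazurRubin2004, Def. 2.1.1 and §4.3] [cite: Sakamoto2024, Def. 3.3 (p. 922)] -/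
theorem relIndex_atLevel_strictAt_relaxedAt_eq (inv : LocalInvariants K p)
    (hperf : inv.IsPerfect) (hvan : inv.SumLocalTermEqZero) (hcomp : inv.SelmerComplement)
    (hEP : ∀ v : HeightOneSpectrum (𝓞 K), localEulerPoincareCharacteristic (v.adicCompletion K))
    (hreal : ∀ w : InfinitePlace K, w.IsReal → Injective (inv (Sum.inl w)))
    {D : KolyvaginDatum (W.torsionGaloisModule (p : ℤ))}
    (hD : D.transverse = cyclotomicTransverse (W.torsionGaloisModule (p : ℤ)))
    (T : Finset (HeightOneSpectrum (𝓞 K)))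
    (hpT : ∀ q ∈ T, ((p : ℕ) : 𝓞 K) ∉ q.asIdeal)
    (hur : ∀ q ∈ T, GaloisRep.IsUnramifiedAt q (W.torsionGaloisModule (p : ℤ)))
    (hprime : ∀ q ∈ T, (Ideal.absNorm q.asIdeal).Prime)
    (hM : ∀ q ∈ T, ∀ m : geomTorsion W p, (Ideal.absNorm q.asIdeal - 1) • m = 0)
    (hχI : ∀ q ∈ T, ∀ [Fact (Ideal.absNorm q.asIdeal).Prime]
      [NeZero ((Ideal.absNorm q.asIdeal : ℕ) : q.adicCompletion K)],
      ∀ u : (ZMod (Ideal.absNorm q.asIdeal))ˣ, ∃ t ∈ absInertia (q.adicCompletion K),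
        modPCyclotomicCharacterZMod (q.adicCompletion K) (Ideal.absNorm q.asIdeal) t = u)
    (hcyc : ∀ q ∈ T, ∃ R : geomTorsion W p, ∀ S : geomTorsion W p,
      (∀ g : absoluteGaloisGroup (q.adicCompletion K), GaloisRep.toLocal q (W.torsionGaloisModule p) g S = S) →
        ∃ a : ℕ, S = a • R)
    (w₀ : HeightOneSpectrum (𝓞 K)) :
    ((D.atLevel (W.kummerSelmerStructure (p : ℤ)) T).strictAt {w₀}).selmerGroup.relIndex
        ((D.atLevel (W.kummerSelmerStructure (p : ℤ)) T).relaxedAt {w₀}).selmerGroup =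
      Nat.card (nsmulAddMonoidHom p : (W.baseChange (w₀.adicCompletion K)).toAffine.Point →+ _).ker *
        Nat.card (w₀.adicCompletionIntegers K ⧸ Ideal.span {(p : w₀.adicCompletionIntegers K)}) := by
  change (((W.kummerSelmerStructure (p : ℤ)).transverseAt D.transverse T).strictAt {w₀}).selmerGroup.relIndex
      (((W.kummerSelmerStructure (p : ℤ)).transverseAt D.transverse T).relaxedAt {w₀}).selmerGroup = _
  rw [hD]
  exact relIndex_transverseAt_strictAt_relaxedAt_eq W p inv hperf hvan hcomp hEP hreal T hpT hur hprime
    hM hχI hcyc w₀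

end Level

/-! ## §N5. At the Frobenius-class (Kolyvagin) primes of `τ`: `p ∉ 𝔮`, unramifiedness, `(N𝔮 − 1)·E[p] = 0`
and the cyclicity flag are supplied by the tree -/

section FrobeniusClass

variable {K : Type} [Field K] [NumberField K] (W : WeierstrassCurve K) [W.IsElliptic]
variable (p : ℕ) [hp : Fact p.Prime]

/-- **`#E[p]^{Γ_{K_𝔮}} = N` at a Frobenius-class prime `𝔮` of `τ` with `E[p]/(τ − 1)E[p] ≃ ℤ/N`** —
the tree's `GaloisImage.natCard_invariants_toLocal_of_mem_frobeniusClassPrimes` (Rubin PCMI Def. 2.1.3: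
the invariants of the local module are the fixed points of a Frobenius in the class of `τ`), read on
the subtype of `Γ_{K_𝔮}`-fixed `p`-torsion points used by file 1's cyclicity flag.
[cite: Rubin2011, Def. 2.1.3 (p. 17)] [cite: Sakamoto2024, §2 (pp. 920–921), the set 𝒫] -/
theorem natCard_fixed_toLocal_eq_of_mem_frobeniusClassPrimes {S : Set (HeightOneSpectrum (𝓞 K))}
    {τ : absoluteGaloisGroup K} {N : ℕ} {q : HeightOneSpectrum (𝓞 K)}
    (hq : q ∈ frobeniusClassPrimes (W.torsionGaloisModule (p : ℤ)) S τ N)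
    (hτ : Nonempty (cokerSubOne (W.torsionGaloisModule (p : ℤ)) τ ≃+ ZMod N)) :
    Nat.card {R : geomTorsion W p //
      ∀ g : absoluteGaloisGroup (q.adicCompletion K), GaloisRep.toLocal q (W.torsionGaloisModule p) g R = R} =
      N := by
  haveI := finite_geomTorsion_of_neZero W p
  rw [← GaloisImage.natCard_invariants_toLocal_of_mem_frobeniusClassPrimes (W.torsionGaloisModule (p : ℤ))
    hq hτ]
  exact Nat.card_congr (Equiv.subtypeEquivRight fun R => Iff.rfl)

/-- **THE LEVEL COUNT AT KOLYVAGIN PRIMES — `T ⊆ frobeniusClassPrimes E[p] S τ p`**, `τ ∈ Γ_K` with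
`E[p]/(τ − 1)E[p] ≃ ℤ/p` (`hτ`) fixing `μ_p` (`hτμ`; Mazur–Rubin §3.5 / Rubin PCMI Def. 2.1.3: the
Kolyvagin primes are the good primes `𝔮 ∤ p`, unramified in `K(E[p])`, whose Frobenius class is that of
`τ` in `Gal(K(μ_p, E[p])/K)`).  Then `p ∉ 𝔮`, `E[p]` unramified at `𝔮`, `(N𝔮 − 1)·E[p] = 0`
(`GaloisImage.absNorm_sub_one_smul_eq_zero_of_mem_frobeniusClassPrimes`) and the cyclicity flag
`#E[p]^{Γ_{K_𝔮}} = p` (`natCard_fixed_toLocal_eq_of_mem_frobeniusClassPrimes`) come from the tree, and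

  `[H¹_{𝓚(T)^{v₀}}(K, E[p]) : H¹_{𝓚(T)_{v₀}}(K, E[p])] = #E(K_{v₀})[p] · #(𝓞_{v₀}/p)`

holds GIVEN `inv` (Poitou–Tate properties + injective at the real places), Tate's local Euler
characteristic `hEP`, and at each `𝔮 ∈ T` only `N𝔮` prime (`hprime`) and the total ramification of
`K_𝔮(μ_{N𝔮})/K_𝔮` (`hχI`) — both automatic when `K = ℚ` (file 3).  CONDITIONAL; nothing booked; O1 OPEN.
[cite: MazurRubin2004, §3.5 and Def. 2.1.1] [cite: Rubin2011, Def. 2.1.1 and Def. 2.1.3 (p. 17)]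
[cite: Sakamoto2024, §2 and Def. 3.3 (pp. 920–922)] [cite: MilneADT2006, Ch. I, Thm. 2.8 and Thm. 4.10] -/
theorem relIndex_transverseAt_update_bot_update_top_eq_of_mem_frobeniusClassPrimes (inv : LocalInvariants K p)
    (hperf : inv.IsPerfect) (hvan : inv.SumLocalTermEqZero) (hcomp : inv.SelmerComplement)
    (hEP : ∀ v : HeightOneSpectrum (𝓞 K), localEulerPoincareCharacteristic (v.adicCompletion K))
    (hreal : ∀ w : InfinitePlace K, w.IsReal → Injective (inv (Sum.inl w)))
    {S : Set (HeightOneSpectrum (𝓞 K))} {τ : absoluteGaloisGroup K}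
    (hτ : Nonempty (cokerSubOne (W.torsionGaloisModule (p : ℤ)) τ ≃+ ZMod p))
    (hτμ : τ ∈ rootsOfUnityFixer K p)
    (T : Finset (HeightOneSpectrum (𝓞 K)))
    (hT : ∀ q ∈ T, q ∈ frobeniusClassPrimes (W.torsionGaloisModule (p : ℤ)) S τ p)
    (hprime : ∀ q ∈ T, (Ideal.absNorm q.asIdeal).Prime)
    (hχI : ∀ q ∈ T, ∀ [Fact (Ideal.absNorm q.asIdeal).Prime]
      [NeZero ((Ideal.absNorm q.asIdeal : ℕ) : q.adicCompletion K)],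
      ∀ u : (ZMod (Ideal.absNorm q.asIdeal))ˣ, ∃ t ∈ absInertia (q.adicCompletion K),
        modPCyclotomicCharacterZMod (q.adicCompletion K) (Ideal.absNorm q.asIdeal) t = u)
    (w₀ : HeightOneSpectrum (𝓞 K)) :
    (SelmerStructure.selmerGroup (Function.update
          ((W.kummerSelmerStructure (p : ℤ)).transverseAt
            (cyclotomicTransverse (W.torsionGaloisModule (p : ℤ))) T) (Sum.inr w₀) ⊥ :
          SelmerStructure (W.torsionGaloisModule (p : ℤ)))).relIndex
        (SelmerStructure.selmerGroup (Function.update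
          ((W.kummerSelmerStructure (p : ℤ)).transverseAt
            (cyclotomicTransverse (W.torsionGaloisModule (p : ℤ))) T) (Sum.inr w₀) ⊤ :
          SelmerStructure (W.torsionGaloisModule (p : ℤ)))) =
      Nat.card (nsmulAddMonoidHom p : (W.baseChange (w₀.adicCompletion K)).toAffine.Point →+ _).ker *
        Nat.card (w₀.adicCompletionIntegers K ⧸ Ideal.span {(p : w₀.adicCompletionIntegers K)}) :=
  relIndex_transverseAt_update_bot_update_top_eq_of_natCard_le W p inv hperf hvan hcomp hEP hreal T
    (fun q hq => (hT q hq).2.1) (fun q hq => (hT q hq).2.2.1) hprime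
    (fun q hq m => GaloisImage.absNorm_sub_one_smul_eq_zero_of_mem_frobeniusClassPrimes
      (W.torsionGaloisModule (p : ℤ)) (hT q hq) hτμ (fun m : geomTorsion W p => AddSubgroup.torsionBy.nsmul m) m)
    hχI (fun q hq => (natCard_fixed_toLocal_eq_of_mem_frobeniusClassPrimes W p (hT q hq) hτ).le) w₀

/-- **THE LEVEL COUNT AT KOLYVAGIN PRIMES, CONDITIONAL ON TWO NAMED FACTS ONLY.**  The relative index
`[H¹_{𝓚(T)^{v₀}} : H¹_{𝓚(T)_{v₀}}]` does not mention the local invariant maps, so the family `inv` and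
its five properties can be taken from the tree's cited named fact
`poitouTate_selmerStructure_duality_real K` (Poitou–Tate duality for Selmer structures WITH the
real-place clause, Milne ADT I Ex. 1.6 (c) / Thm. 4.10 (b), Howard Thm. 2.1.11; b2b-bsdres-lit GEN 53):
GIVEN that fact (`hPT`) and Tate's local Euler–Poincaré characteristic at the finite places (`hEP`, the
named fact `localEulerPoincareCharacteristic`), for `τ` with `E[p]/(τ − 1)E[p] ≃ ℤ/p` fixing `μ_p` and
every finite `T ⊆ frobeniusClassPrimes E[p] S τ p` with `N𝔮` prime and `hχI` at its primes,
`[H¹_{𝓚(T)^{v₀}}(K, E[p]) : H¹_{𝓚(T)_{v₀}}(K, E[p])] = #E(K_{v₀})[p] · #(𝓞_{v₀}/p)`.  CONDITIONAL on the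
two named facts (hypotheses, not discharged); nothing booked; O1 OPEN.
[cite: MilneADT2006, Ch. I, Example 1.6 (c) (p. 19), Thm. 2.8 and Thm. 4.10(b) (p. 57)]
[cite: Howard2004HeegnerKolyvagin, Thm. 2.1.11 (arXiv:1202.6340 p. 6)] [cite: MazurRubin2004, §3.5 and Def. 2.1.1] -/
theorem relIndex_transverseAt_update_bot_update_top_eq_of_facts
    (hPT : poitouTate_selmerStructure_duality_real K)
    (hEP : ∀ v : HeightOneSpectrum (𝓞 K), localEulerPoincareCharacteristic (v.adicCompletion K))
    {S : Set (HeightOneSpectrum (𝓞 K))} {τ : absoluteGaloisGroup K}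
    (hτ : Nonempty (cokerSubOne (W.torsionGaloisModule (p : ℤ)) τ ≃+ ZMod p))
    (hτμ : τ ∈ rootsOfUnityFixer K p)
    (T : Finset (HeightOneSpectrum (𝓞 K)))
    (hT : ∀ q ∈ T, q ∈ frobeniusClassPrimes (W.torsionGaloisModule (p : ℤ)) S τ p)
    (hprime : ∀ q ∈ T, (Ideal.absNorm q.asIdeal).Prime)
    (hχI : ∀ q ∈ T, ∀ [Fact (Ideal.absNorm q.asIdeal).Prime]
      [NeZero ((Ideal.absNorm q.asIdeal : ℕ) : q.adicCompletion K)],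
      ∀ u : (ZMod (Ideal.absNorm q.asIdeal))ˣ, ∃ t ∈ absInertia (q.adicCompletion K),
        modPCyclotomicCharacterZMod (q.adicCompletion K) (Ideal.absNorm q.asIdeal) t = u)
    (w₀ : HeightOneSpectrum (𝓞 K)) :
    (SelmerStructure.selmerGroup (Function.update
          ((W.kummerSelmerStructure (p : ℤ)).transverseAt
            (cyclotomicTransverse (W.torsionGaloisModule (p : ℤ))) T) (Sum.inr w₀) ⊥ :
          SelmerStructure (W.torsionGaloisModule (p : ℤ)))).relIndex
        (SelmerStructure.selmerGroup (Function.update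
          ((W.kummerSelmerStructure (p : ℤ)).transverseAt
            (cyclotomicTransverse (W.torsionGaloisModule (p : ℤ))) T) (Sum.inr w₀) ⊤ :
          SelmerStructure (W.torsionGaloisModule (p : ℤ)))) =
      Nat.card (nsmulAddMonoidHom p : (W.baseChange (w₀.adicCompletion K)).toAffine.Point →+ _).ker *
        Nat.card (w₀.adicCompletionIntegers K ⧸ Ideal.span {(p : w₀.adicCompletionIntegers K)}) := by
  obtain ⟨inv, hperf, hvan, -, hcomp, hreal⟩ := hPT p
  exact relIndex_transverseAt_update_bot_update_top_eq_of_mem_frobeniusClassPrimes W p inv hperf hvan hcomp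
    hEP hreal hτ hτμ T hT hprime hχI w₀

end FrobeniusClass

end Summit.BirchSwinnertonDyer.Rank1Residual.X5.TransverseCount

end
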